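import Mathlib
import Summits.NavierStokesRegularity.NavierStokesRegularity.Theorems.EulerZoomLiouvillePowerGaugeEulerLiouvilleSelfSimilarEndpointPressure
import Literature.Analysis.FunctionSpaces.SobolevBallScaling
import Literature.Analysis.FluidPDE.LeraySeparationOfEnergyTools
import HarnessLib

/-!
# Rung C1 of the crux `EulerZoomLiouville.PowerGaugeEulerLiouville` at the endpoint `ρ = 1/2`:
# the local Sobolev inequality for the profile and the Lebesgue interpolations replacing the
# pointwise sublinear growth bound

Route №10 `EulerZoomLiouville` (NavierStokesRegularity), crux E = stmt-NavierStokesRegularity-19832,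
registered open stub `stub_selfSimilarWeakRest`, endpoint `ρ = 1/2`.  In Chae–Shvydkoy's proof of
Thm 3.1 (ARMA 209 (2013) = arXiv:1201.6009, §3.1) and in the tree's `shell_cubic_le` /
`shell_pressure_le` (`…SelfSimilarEndpointPressure`) the POINTWISE growth `‖V(y)‖ ≤ C_up|y|^{1−δ}`
bounds the cubic flux `∫_S ‖V‖³` and the mid Riesz source `‖V·1_T‖₄²` by `sup_T ‖V‖ × energy`.
In Seregin's class the profile `V ∈ L²(ℝ³)` has a WEAK GRADIENT `G` with `∫ |G|²_F |y|^{−1/2} ≤ c/5`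
(`profileData_of_selfSimilar`), and this file provides the replacements with NO pointwise input:

* `EndpointSobolev.exists_sobolev_six_ball` — the tree's scale-invariant Sobolev inequality on balls
  (`Literature.Analysis.FunctionSpaces.exists_eLpNorm_le_ball`, `W^{1,2}(B) ⊂ L⁶(B)` with
  `‖f‖_{L⁶(B_r)} ≤ C (r⁻¹‖f‖_{L²(B_r)} + ‖Df‖_{L²(B_r)})`) in the REAL form used by the shell
  recursion: `∫_{B_r} ‖V‖⁶ ≤ (C (r⁻¹ √(∫‖V‖²) + √M))⁶` whenever `∫_{B_r} |G|²_F ≤ M`;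
* `EndpointSobolev.integrableOn_norm_pow_four`, `…setIntegral_norm_pow_four_le`,
  `…setIntegral_norm_pow_three_le` — Cauchy–Schwarz twice:
  `∫_A ‖V‖⁴ ≤ √(∫_A ‖V‖⁶) √(∫_A ‖V‖²)` and `∫_A ‖V‖³ ≤ (∫_A ‖V‖⁶)^{1/4} (∫_A ‖V‖²)^{3/4}`.

With `∫_{B_{32L}} |G|²_F ≲ L^{1/2}` these give `∫_S ‖V‖³ ≲ L^{3/8} e^{3/4}` and
`‖V·1_T‖₄² ≲ L^{3/8} e_T^{3/4}`, the inputs of the growth-free shell recursion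
`f(L) ≤ C₁ L^{−5/8} S(L)^{3/4} + C₂ √S(L) L^{−5/2}` (`…SelfSimilarEndpointSobolevIteration`).

WHAT THIS IS NOT: not NS, not E, not the stub — measure-theoretic tools for one endpoint stratum.
-/

noncomputable section

-- flat `Theorems/<Route><Decl>…` files of one crux share the namespace of the crux (tree convention)
set_option linter.dupNamespace false

open MeasureTheory Set Filter Topology Metric Function TopologicalSpace
open scoped ENNReal NNReal

namespace Summit.NavierStokesRegularity.NavierStokesRegularity.Theorems.PowerGaugeEulerLiouville

open Literature.Analysis Literature.Analysis.FluidPDE Literature.Analysis.FunctionSpaces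

namespace EndpointSobolev

section Interpolation

variable {V : EuclideanSpace ℝ (Fin 3) → EuclideanSpace ℝ (Fin 3)}

/-- `‖V‖⁴ ∈ L¹(A)` when `‖V‖², ‖V‖⁶ ∈ L¹(A)` (pointwise `t⁴ ≤ t² + t⁶`). [folklore] -/
theorem integrableOn_norm_pow_four (hVm : AEStronglyMeasurable V volume)
    {A : Set (EuclideanSpace ℝ (Fin 3))}
    (h2 : IntegrableOn (fun y => ‖V y‖ ^ 2) A volume)
    (h6 : IntegrableOn (fun y => ‖V y‖ ^ 6) A volume) :
    IntegrableOn (fun y => ‖V y‖ ^ 4) A volume := by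
  refine Integrable.mono' (h2.add h6) ((hVm.restrict).norm.pow 4) (Eventually.of_forall fun y => ?_)
  rw [Real.norm_eq_abs, abs_of_nonneg (by positivity), Pi.add_apply]
  have h : 0 ≤ ‖V y‖ ^ 2 * ((‖V y‖ ^ 2 - 1) ^ 2 + ‖V y‖ ^ 2) := by positivity
  nlinarith [h]

/-- **Cauchy–Schwarz:** `∫_A ‖V‖⁴ ≤ √(∫_A ‖V‖⁶) √(∫_A ‖V‖²)`. [folklore] -/
theorem setIntegral_norm_pow_four_le (hVm : AEStronglyMeasurable V volume)
    {A : Set (EuclideanSpace ℝ (Fin 3))}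
    (h2 : IntegrableOn (fun y => ‖V y‖ ^ 2) A volume)
    (h6 : IntegrableOn (fun y => ‖V y‖ ^ 6) A volume) :
    ∫ y in A, ‖V y‖ ^ 4 ≤ Real.sqrt (∫ y in A, ‖V y‖ ^ 6) * Real.sqrt (∫ y in A, ‖V y‖ ^ 2) := by
  have hf : MemLp (fun y => ‖V y‖ ^ 3) 2 (volume.restrict A) := by
    refine (memLp_two_iff_integrable_sq (hVm.restrict.norm.pow 3)).2 ?_
    refine h6.congr (Eventually.of_forall fun y => ?_)
    simp only [Pi.pow_apply]
    ring
  have hV : MemLp V 2 (volume.restrict A) := (memLp_two_iff_integrable_sq_norm hVm.restrict).2 h2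
  have h := setIntegral_abs_mul_norm_le_sqrt hf hV
  have e1 : ∫ y in A, |‖V y‖ ^ 3| * ‖V y‖ = ∫ y in A, ‖V y‖ ^ 4 := by
    refine integral_congr_ae (Eventually.of_forall fun y => ?_)
    simp only
    rw [abs_of_nonneg (by positivity)]
    ring
  have e2 : ∫ y in A, (‖V y‖ ^ 3) ^ 2 = ∫ y in A, ‖V y‖ ^ 6 := by
    refine integral_congr_ae (Eventually.of_forall fun y => ?_)
    simp only
    ring
  rw [e1, e2] at h
  exact h

/-- **Two Cauchy–Schwarz steps:** `∫_A ‖V‖³ ≤ (∫_A ‖V‖⁶)^{1/4} (∫_A ‖V‖²)^{3/4}`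
(`∫‖V‖³ ≤ √(∫‖V‖⁴) √(∫‖V‖²)` and `setIntegral_norm_pow_four_le`). [folklore] -/
theorem setIntegral_norm_pow_three_le (hVm : AEStronglyMeasurable V volume)
    {A : Set (EuclideanSpace ℝ (Fin 3))}
    (h2 : IntegrableOn (fun y => ‖V y‖ ^ 2) A volume)
    (h6 : IntegrableOn (fun y => ‖V y‖ ^ 6) A volume) :
    ∫ y in A, ‖V y‖ ^ 3 ≤
      (∫ y in A, ‖V y‖ ^ 6) ^ (1 / 4 : ℝ) * (∫ y in A, ‖V y‖ ^ 2) ^ (3 / 4 : ℝ) := by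
  have h4 := integrableOn_norm_pow_four hVm h2 h6
  have hf : MemLp (fun y => ‖V y‖ ^ 2) 2 (volume.restrict A) := by
    refine (memLp_two_iff_integrable_sq (hVm.restrict.norm.pow 2)).2 ?_
    refine h4.congr (Eventually.of_forall fun y => ?_)
    simp only [Pi.pow_apply]
    ring
  have hV : MemLp V 2 (volume.restrict A) := (memLp_two_iff_integrable_sq_norm hVm.restrict).2 h2
  have h := setIntegral_abs_mul_norm_le_sqrt hf hV
  have e1 : ∫ y in A, |‖V y‖ ^ 2| * ‖V y‖ = ∫ y in A, ‖V y‖ ^ 3 := by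
    refine integral_congr_ae (Eventually.of_forall fun y => ?_)
    simp only
    rw [abs_of_nonneg (by positivity)]
    ring
  have e2 : ∫ y in A, (‖V y‖ ^ 2) ^ 2 = ∫ y in A, ‖V y‖ ^ 4 := by
    refine integral_congr_ae (Eventually.of_forall fun y => ?_)
    simp only
    ring
  rw [e1, e2] at h
  set q : ℝ := ∫ y in A, ‖V y‖ ^ 6 with hq
  set e : ℝ := ∫ y in A, ‖V y‖ ^ 2 with he
  have hq0 : 0 ≤ q := by
    rw [hq]; exact integral_nonneg fun y => by positivity
  have he0 : 0 ≤ e := by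
    rw [he]; exact integral_nonneg fun y => by positivity
  have h4le := setIntegral_norm_pow_four_le hVm h2 h6
  calc ∫ y in A, ‖V y‖ ^ 3 ≤ Real.sqrt (∫ y in A, ‖V y‖ ^ 4) * Real.sqrt e := h
    _ ≤ Real.sqrt (Real.sqrt q * Real.sqrt e) * Real.sqrt e := by
        gcongr
    _ = q ^ (1 / 4 : ℝ) * e ^ (3 / 4 : ℝ) := by
        rw [Real.sqrt_eq_rpow, Real.sqrt_eq_rpow, Real.sqrt_eq_rpow,
          Real.mul_rpow (Real.rpow_nonneg hq0 _) (Real.rpow_nonneg he0 _),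
          ← Real.rpow_mul hq0, ← Real.rpow_mul he0, mul_assoc, ← Real.rpow_add' he0 (by norm_num)]
        norm_num

end Interpolation

section Sobolev

/-- **The scale-invariant Sobolev inequality on balls for a weakly differentiable `L²` field, real
form.**  There is an absolute constant `C ≥ 0` such that: if `V ∈ L²(ℝ³; ℝ³)` has a weak derivative
`G` on `ℝ³` and `∫_{B_r} |G|²_F ≤ M` (`r > 0`, `M ≥ 0`), then `‖V‖⁶ ∈ L¹(B_r)` and
`∫_{B_r} ‖V‖⁶ ≤ (C (r⁻¹ √(∫ ‖V‖²) + √M))⁶`.  This is `Literature.Analysis.FunctionSpaces.exists_eLpNorm_le_ball`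
(`W^{1,2}(B_r) ⊂ L⁶(B_r)`, constant independent of `r`; Lemarié-Rieusset 2016 (13.17)) with
`‖G‖_op² ≤ |G|²_F` (`norm_sq_le_frobeniusNormSq`) and `‖V‖_{L²(B_r)} ≤ ‖V‖_{L²(ℝ³)}`. [folklore] -/
theorem exists_sobolev_six_ball :
    ∃ C : ℝ, 0 ≤ C ∧
      ∀ (V : EuclideanSpace ℝ (Fin 3) → EuclideanSpace ℝ (Fin 3))
        (G : EuclideanSpace ℝ (Fin 3) → EuclideanSpace ℝ (Fin 3) →L[ℝ] EuclideanSpace ℝ (Fin 3)),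
        HasWeakFDerivOn (⊤ : Opens (EuclideanSpace ℝ (Fin 3))) volume V G →
        AEStronglyMeasurable V volume → AEStronglyMeasurable G volume →
        Integrable (fun y => ‖V y‖ ^ 2) volume →
        ∀ (r M : ℝ), 0 < r → 0 ≤ M →
        (∫⁻ y in ball (0 : EuclideanSpace ℝ (Fin 3)) r, ENNReal.ofReal (frobeniusNormSq (G y))) ≤
            ENNReal.ofReal M →
        IntegrableOn (fun y => ‖V y‖ ^ 6) (ball (0 : EuclideanSpace ℝ (Fin 3)) r) volume ∧
        ∫ y in ball (0 : EuclideanSpace ℝ (Fin 3)) r, ‖V y‖ ^ 6 ≤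
          (C * (r⁻¹ * Real.sqrt (∫ y, ‖V y‖ ^ 2) + Real.sqrt M)) ^ 6 := by
  obtain ⟨C, hC⟩ := exists_eLpNorm_le_ball (E := EuclideanSpace ℝ (Fin 3))
    (F := EuclideanSpace ℝ (Fin 3)) (p := 2) (p' := 6) (by norm_num)
    (by rw [finrank_euclideanSpace_fin]; norm_num) (by rw [finrank_euclideanSpace_fin]; norm_num)
  refine ⟨C, C.coe_nonneg, fun V G hW hVm hGm hV2 r M hr hM hGB => ?_⟩
  set B : Set (EuclideanSpace ℝ (Fin 3)) := ball 0 r with hB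
  set Ω : Opens (EuclideanSpace ℝ (Fin 3)) := ⟨B, isOpen_ball⟩ with hΩ
  have hWΩ : HasWeakFDerivOn Ω volume V G := HasWeakFDerivOn.mono_set_holds hW le_top
  have hV2B : MemLp V 2 (volume.restrict B) :=
    (memLp_two_iff_integrable_sq_norm hVm.restrict).2 hV2.integrableOn
  -- the Frobenius density is integrable on the ball
  have hfrobm : AEStronglyMeasurable (fun y => frobeniusNormSq (G y)) volume :=
    continuous_frobeniusNormSq'.comp_aestronglyMeasurable hGm
  have hfrob_lt : (∫⁻ y in B, ENNReal.ofReal (frobeniusNormSq (G y))) < ⊤ :=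
    hGB.trans_lt ENNReal.ofReal_lt_top
  have hfrobI : IntegrableOn (fun y => frobeniusNormSq (G y)) B volume := by
    refine ⟨hfrobm.restrict, ?_⟩
    rw [hasFiniteIntegral_iff_ofReal (Eventually.of_forall fun y => frobeniusNormSq_nonneg _)]
    exact hfrob_lt
  -- the components of `G` are in `L²(B)`
  have hGv : ∀ v : EuclideanSpace ℝ (Fin 3), MemLp (fun x => G x v) 2 (volume.restrict B) := by
    intro v
    have hmeas : AEStronglyMeasurable (fun x => G x v) (volume.restrict B) :=
      ((ContinuousLinearMap.apply ℝ (EuclideanSpace ℝ (Fin 3)) v).continuous.comp_aestronglyMeasurable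
        hGm).restrict
    refine (memLp_two_iff_integrable_sq_norm hmeas).2 ?_
    refine Integrable.mono' (hfrobI.mul_const (‖v‖ ^ 2)) (hmeas.norm.pow 2)
      (Eventually.of_forall fun x => ?_)
    rw [Real.norm_eq_abs, abs_of_nonneg (by positivity)]
    calc ‖G x v‖ ^ 2 ≤ (‖G x‖ * ‖v‖) ^ 2 :=
          pow_le_pow_left₀ (norm_nonneg _) (ContinuousLinearMap.le_opNorm _ _) 2
      _ = ‖G x‖ ^ 2 * ‖v‖ ^ 2 := by ring
      _ ≤ frobeniusNormSq (G x) * ‖v‖ ^ 2 :=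
          mul_le_mul_of_nonneg_right (norm_sq_le_frobeniusNormSq _) (by positivity)
  -- `V ∈ W^{1,2}(B)`
  have hSob : MemSobolevDomain 1 (2 : ℝ≥0) Ω volume V :=
    (memSobolevDomain_succ_iff (k := 0)).2
      ⟨hV2B, G, hWΩ, fun v => memSobolevDomain_zero_iff.2 (hGv v)⟩
  have hS := hC 0 r hr V G hSob hWΩ
  -- the two norms on the right
  set E₂ : ℝ := ∫ y, ‖V y‖ ^ 2 with hE₂
  have hE₂0 : 0 ≤ E₂ := integral_nonneg fun y => by positivity
  have hV2all : MemLp V 2 volume := (memLp_two_iff_integrable_sq_norm hVm).2 hV2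
  have h2le : eLpNorm V 2 (volume.restrict B) ≤ ENNReal.ofReal (Real.sqrt E₂) := by
    refine (eLpNorm_mono_measure V Measure.restrict_le_self).trans (le_of_eq ?_)
    rw [hV2all.eLpNorm_eq_integral_rpow_norm (by norm_num) (by norm_num), Real.sqrt_eq_rpow, hE₂]
    congr 2
    · refine integral_congr_ae (Eventually.of_forall fun y => ?_)
      simp only [ENNReal.toReal_ofNat, Real.rpow_two]
    · norm_num
  have hGle : eLpNorm G 2 (volume.restrict B) ≤ ENNReal.ofReal (Real.sqrt M) := by
    rw [eLpNorm_eq_lintegral_rpow_enorm_toReal (by norm_num) (by norm_num), ENNReal.toReal_ofNat,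
      Real.sqrt_eq_rpow, ← ENNReal.ofReal_rpow_of_nonneg hM (by norm_num)]
    refine ENNReal.rpow_le_rpow ?_ (by norm_num)
    refine le_trans (lintegral_mono fun y => ?_) hGB
    rw [← ofReal_norm, ENNReal.ofReal_rpow_of_nonneg (norm_nonneg _) (by norm_num),
      Real.rpow_two]
    exact ENNReal.ofReal_le_ofReal (norm_sq_le_frobeniusNormSq _)
  -- the Sobolev bound in real form
  set N : ℝ := C * (r⁻¹ * Real.sqrt E₂ + Real.sqrt M) with hN
  have hN0 : 0 ≤ N := by positivity
  have h6le : eLpNorm V 6 (volume.restrict B) ≤ ENNReal.ofReal N := by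
    have h1 : eLpNorm V ((6 : ℝ≥0) : ℝ≥0∞) (volume.restrict B) ≤
        C * ((ENNReal.ofReal r)⁻¹ * ENNReal.ofReal (Real.sqrt E₂) + ENNReal.ofReal (Real.sqrt M)) := by
      refine hS.trans ?_
      push_cast
      gcongr
    have h2 : (C : ℝ≥0∞) * ((ENNReal.ofReal r)⁻¹ * ENNReal.ofReal (Real.sqrt E₂) +
        ENNReal.ofReal (Real.sqrt M)) = ENNReal.ofReal N := by
      rw [hN, ENNReal.ofReal_mul C.coe_nonneg, ENNReal.ofReal_coe_nnreal,
        ENNReal.ofReal_add (by positivity) (Real.sqrt_nonneg _),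
        ENNReal.ofReal_mul (inv_nonneg.2 hr.le), ENNReal.ofReal_inv_of_pos hr]
    have h3 : eLpNorm V 6 (volume.restrict B) = eLpNorm V ((6 : ℝ≥0) : ℝ≥0∞) (volume.restrict B) := by
      norm_cast
    rw [h3]
    exact h1.trans (le_of_eq h2)
  have hV6 : MemLp V 6 (volume.restrict B) := ⟨hVm.restrict, h6le.trans_lt ENNReal.ofReal_lt_top⟩
  have hI6 : IntegrableOn (fun y => ‖V y‖ ^ 6) B volume := by
    have h6i : Integrable (fun y => ‖V y‖ ^ (6 : ℝ≥0∞).toReal) (volume.restrict B) :=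
      hV6.integrable_norm_rpow (by norm_num) (by norm_num)
    refine h6i.congr (Eventually.of_forall fun y => ?_)
    simp only [ENNReal.toReal_ofNat]
    norm_cast
  refine ⟨hI6, ?_⟩
  -- `∫_B ‖V‖⁶ = ‖V‖_{L⁶(B)}⁶ ≤ N⁶`
  have hq0 : 0 ≤ ∫ y in B, ‖V y‖ ^ 6 := integral_nonneg fun y => by positivity
  rw [hV6.eLpNorm_eq_integral_rpow_norm (by norm_num) (by norm_num), ENNReal.toReal_ofNat,
    ENNReal.ofReal_le_ofReal_iff hN0] at h6le
  have h6' : (∫ y in B, ‖V y‖ ^ 6) ^ ((6 : ℕ) : ℝ)⁻¹ ≤ N := by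
    convert h6le using 2
    · refine integral_congr_ae (Eventually.of_forall fun y => ?_)
      norm_cast
    · norm_num
  calc ∫ y in B, ‖V y‖ ^ 6 = ((∫ y in B, ‖V y‖ ^ 6) ^ ((6 : ℕ) : ℝ)⁻¹) ^ 6 :=
        (Real.rpow_inv_natCast_pow hq0 (by norm_num)).symm
    _ ≤ N ^ 6 := pow_le_pow_left₀ (Real.rpow_nonneg hq0 _) h6' 6

end Sobolev

end EndpointSobolev

end Summit.NavierStokesRegularity.NavierStokesRegularity.Theorems.PowerGaugeEulerLiouville
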